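import Summits.BirchSwinnertonDyer.Rank1Residual.X11b.BDPRouteStrictAtPlace
import HarnessLib

/-!
# Class X11b, routes p2/R1: PART A WITH a torsion-valued local condition —
# `#(Sel⁽ⁿ⁾ ∩ res_E⁻¹ κ_E(T)) · [E(E) : T + nE(E)] ≤ #Ш[n] · [E(K):nE(K)] · [E(E) : T + nE(E) + im E(K)]`
# (cell `b2b-bsdres`, sub-cell `multr1-p2`, gen 17)

HONEST FRAMING (verbatim, cell `b2b-bsdres`): the goal of the cell is to DELETE the
COMBINATION-SHAPED residual classes for ALL analytic-rank `≤ 1` curves over `ℚ` — "full BSD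
formula for every rank `≤ 1` curve in class `C`" assembled STRICTLY from published theorems — so
that the rank-`≤ 1` remainder becomes exactly the CONSTRUCTION-SHAPED classes, which are TYPED
(missing-input Props), NOT attempted; this is not "finishing BSD". Research route `p2` for class
X11b; no claim beyond the stated class; nothing booked; X11b stays CONSTRUCTION-SHAPED. Theorems
only; no definition; no `sorry`; no named fact. Continues `BDPRouteStrictAtPlace.lean` (gen 15).

## What this file proves (namespace `Summit.BirchSwinnertonDyer.Rank1Residual.X11b.StrictAtPlace`)

Gen 15's Part A bounds the `n`-Selmer classes DYING at a `K`-field `E` (a completion `K_𝔭`). The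
finite-level shadow of Castella's strict condition at `𝔭` on `E[p^∞]`, propagated to `E[p^k]`, is
NOT "dies at `𝔭`" but "lies in the local Kummer image of the TORSION of `E(K_𝔭)`" — the two agree
exactly under (iv) `E(K_𝔭)[p] = 0`. For an arbitrary subgroup `T ≤ (W⁄E)(E)` (intended: the torsion
of `E(K_𝔭)`), with `κ_{n,E} = localKummerMap` and `C = res_E⁻¹(κ_{n,E}(T))`:

* `natCard_selmerGroup_inf_le_of` — `#(Sel⁽ⁿ⁾ ∩ C) ≤ #Ш[n] · #(κ_n(E(K)) ∩ C)` for ANY subgroup `C`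
  (the exact sequence `0 → E(K)/n → Sel⁽ⁿ⁾ → Ш[n] → 0`; gen 15's argument, `C` generalised);
* `natCard_range_kummerMapTorsion_inf_comap` — `#(κ_n(E(K)) ∩ C) = [ι⁻¹(T + n(W⁄E)(E)) : nE(K)]`
  (`res_E κ_n P = κ_{n,E}(P_E)`, `κ_{n,E}⁻¹(κ_{n,E}(T)) = T + n(W⁄E)(E)` since `ker κ_{n,E} = n(W⁄E)(E)`);
* `relIndex_comap_mul_index_sup` — index bookkeeping
  `[ι⁻¹(T + nE(E)) : nE(K)] · [E(E) : T + nE(E)] = [E(K) : nE(K)] · [E(E) : T + nE(E) + im E(K)]`;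
* **`natCard_selmerGroup_inf_comap_mul_index_le`** (assembled):
  `#(Sel⁽ⁿ⁾ ∩ res_E⁻¹ κ_E(T)) · [E(E) : T + nE(E)] ≤ #Ш[n] · [E(K) : nE(K)] · [E(E) : T + nE(E) + im E(K)]`.

With `T = 0` this is gen 15's Part A. At `E = K_𝔭`, `T = E(K_𝔭)_tors`, rank one: `[E(K):p^kE(K)] = p^k`,
`[E(K_𝔭) : T + p^kE(K_𝔭)] = p^k` and the last index is `p^{min(k, e − m)}` (`ZpLineIndexTorsion`),
`p^m = #E(ℚ_p)[p^∞]` — the `#H⁰(K_𝔭, E[p^∞])⁻¹` of JSW Prop. 3.2.1 / Cas18 (calcul). Nothing booked.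

References: [JetchevSkinnerWan2017] Prop. 3.2.1 (arXiv:1512.06894 pp. 10–11); [SilvermanAEC2009]
VIII.§2, X.§4, Thm. X.4.2; [Castella2018] (3.2.1), (calcul).
-/

noncomputable section

open scoped Classical

universe u

namespace Summit.BirchSwinnertonDyer.Rank1Residual.X11b.StrictAtPlace

open WeierstrassCurve Literature.NumberTheory.EllipticCurves Literature.NumberTheory.GaloisRepresentations
  Field Function

variable {K : Type u} [Field K] [NumberField K] (W : WeierstrassCurve K) [W.IsElliptic]
variable (E : Type u) [Field E] [Algebra K E] [CharZero E] {n : ℤ} (hn : n ≠ 0)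

include hn in
/-- **Part A at finite level, arbitrary local condition.** For ANY subgroup `C` of `H¹(K, E[n])`:
`#(Sel⁽ⁿ⁾ ∩ C) ≤ #Ш[n] · #(κ_n(E(K)) ∩ C)` (`0 → E(K)/n → Sel⁽ⁿ⁾ → Ш[n] → 0`: the classes of
`Sel⁽ⁿ⁾ ∩ C` dying in `Ш` are Kummer classes). [cite: SilvermanAEC2009, Thm X.4.2]
[cite: JetchevSkinnerWan2017, Prop. 3.2.1 (proof)] -/
theorem natCard_selmerGroup_inf_le_of
    (hdiv : ∀ P : geomPoints W, ∃ Q : geomPoints W, n • Q = P) (C : AddSubgroup (galH1Torsion W n)) :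
    Nat.card ↥(selmerGroup W n ⊓ C) ≤
      Nat.card ↥(W.sha ⊓ AddSubgroup.torsionBy W.galH1 n) *
        Nat.card ↥((kummerMapTorsion W n hdiv).range ⊓ C) := by
  haveI : PerfectField K := PerfectField.ofCharZero
  haveI : Finite (selmerGroup W n) := W.finite_selmerGroup_holds hn
  have hSha : (selmerGroup W n).map (torsionH1ToH1 W n) = W.sha ⊓ AddSubgroup.torsionBy W.galH1 n :=
    W.map_torsionH1ToH1_selmerGroup_holds hn
  haveI : Finite ↥(W.sha ⊓ AddSubgroup.torsionBy W.galH1 n) := by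
    rw [← hSha]
    exact Finite.of_surjective (fun x : selmerGroup W n =>
      (⟨torsionH1ToH1 W n x, x, x.2, rfl⟩ : (selmerGroup W n).map (torsionH1ToH1 W n)))
      (by rintro ⟨_, x, hx, rfl⟩; exact ⟨⟨x, hx⟩, rfl⟩)
  have h1 := natCard_le_mul_natCard_inf_ker (torsionH1ToH1 W n) (selmerGroup W n ⊓ C)
    (W.sha ⊓ AddSubgroup.torsionBy W.galH1 n) ((AddSubgroup.map_mono inf_le_left).trans hSha.le)
  -- the kernel classes are Kummer classes
  have hsub : (selmerGroup W n ⊓ C) ⊓ (torsionH1ToH1 W n).ker ≤ (kummerMapTorsion W n hdiv).range ⊓ C := by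
    rintro x ⟨⟨-, hxC⟩, hxker⟩
    exact ⟨mem_range_kummerMapTorsion_of_torsionH1ToH1_eq_zero W n hdiv x hxker, hxC⟩
  haveI : Finite ↥((kummerMapTorsion W n hdiv).range ⊓ C) :=
    Finite.Set.subset (selmerGroup W n : Set (galH1Torsion W n)) (by
      rintro x ⟨⟨P, rfl⟩, -⟩
      exact kummerMapTorsion_mem_selmerGroup W hdiv P)
  exact h1.trans (Nat.mul_le_mul_left _ (AddSubgroup.card_le_of_le hsub))

include hn in
/-- **The Kummer classes localising into `κ_{n,E}(T)` come from `ι⁻¹(T + n·(W⁄E)(E))`**: with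
`S = {P ∈ E(K) : P_E ∈ T + n(W⁄E)(E)}`, `#(κ_n(E(K)) ∩ res_E⁻¹(κ_{n,E}(T))) = [S : nE(K)]`
(`res_E κ_n P = κ_{n,E}(P_E)` and `κ_{n,E}⁻¹(κ_{n,E}(T)) = T + ker κ_{n,E} = T + n(W⁄E)(E)`).
[cite: SilvermanAEC2009, VIII.§2 and X.§4 diagram (**)] -/
theorem natCard_range_kummerMapTorsion_inf_comap
    (hdiv : ∀ P : geomPoints W, ∃ Q : geomPoints W, n • Q = P)
    (T : AddSubgroup (W.baseChange E).toAffine.Point) :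
    Nat.card ↥((kummerMapTorsion W n hdiv).range ⊓
        (T.map (W.localKummerMap E hn)).comap (galoisCohomology.res (W.torsionGaloisModule n) E 1)) =
      ((zsmulAddGroupHom n : W.toAffine.Point →+ _).range).relIndex
        ((T ⊔ (zsmulAddGroupHom n : (W.baseChange E).toAffine.Point →+ _).range).comap
          (Affine.Point.baseChange (W' := W) K E)) := by
  haveI : PerfectField K := PerfectField.ofCharZero
  set S : AddSubgroup W.toAffine.Point :=
    (T ⊔ (zsmulAddGroupHom n : (W.baseChange E).toAffine.Point →+ _).range).comap
      (Affine.Point.baseChange (W' := W) K E) with hS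
  -- `κ P` localises into `κ_E(T)` iff `P ∈ S`
  have key : ∀ P : W.toAffine.Point,
      kummerMapTorsion W n hdiv P ∈ (T.map (W.localKummerMap E hn)).comap
          (galoisCohomology.res (W.torsionGaloisModule n) E 1) ↔ P ∈ S := by
    intro P
    have h1 : kummerMapTorsion W n hdiv P ∈ (T.map (W.localKummerMap E hn)).comap
          (galoisCohomology.res (W.torsionGaloisModule n) E 1) ↔
        galoisCohomology.res (W.torsionGaloisModule n) E 1 (kummerMapTorsion W n hdiv P) ∈
          T.map (W.localKummerMap E hn) := Iff.rfl
    have h2 : galoisCohomology.res (W.torsionGaloisModule n) E 1 (kummerMapTorsion W n hdiv P) =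
        W.localKummerMap E hn (Affine.Point.baseChange (W' := W) K E P) :=
      KummerIndex.res_kummerMapTorsion_eq_localKummerMap W E hn hdiv P
    have h3 : W.localKummerMap E hn (Affine.Point.baseChange (W' := W) K E P) ∈
          T.map (W.localKummerMap E hn) ↔
        Affine.Point.baseChange (W' := W) K E P ∈
          (T.map (W.localKummerMap E hn)).comap (W.localKummerMap E hn) := Iff.rfl
    rw [AddSubgroup.comap_map_eq, W.ker_localKummerMap E hn] at h3
    have h4 : P ∈ S ↔ Affine.Point.baseChange (W' := W) K E P ∈
        T ⊔ (zsmulAddGroupHom n : (W.baseChange E).toAffine.Point →+ _).range := Iff.rfl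
    rw [h2] at h1
    exact h1.trans (h3.trans h4.symm)
  -- `κ(S) = κ(E(K)) ⊓ C`
  have hmap : S.map (kummerMapTorsion W n hdiv) = (kummerMapTorsion W n hdiv).range ⊓
      (T.map (W.localKummerMap E hn)).comap (galoisCohomology.res (W.torsionGaloisModule n) E 1) := by
    apply le_antisymm
    · rintro _ ⟨P, hP, rfl⟩
      exact ⟨⟨P, rfl⟩, (key P).mpr hP⟩
    · rintro _ ⟨⟨P, rfl⟩, hP⟩
      exact ⟨P, (key P).mp hP, rfl⟩
  rw [← hmap, ← AddSubgroup.relIndex_ker, kummerMapTorsion_ker]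

omit [NumberField K] [W.IsElliptic] [CharZero E] in
/-- **Index bookkeeping**: with `S = ι⁻¹(T + n(W⁄E)(E))`,
`[S : nE(K)] · [(W⁄E)(E) : T + n(W⁄E)(E)] = [E(K) : nE(K)] · [(W⁄E)(E) : (T + n(W⁄E)(E)) + im E(K)]`.
[folklore] -/
theorem relIndex_comap_mul_index_sup (T : AddSubgroup (W.baseChange E).toAffine.Point) :
    ((zsmulAddGroupHom n : W.toAffine.Point →+ _).range).relIndex
        ((T ⊔ (zsmulAddGroupHom n : (W.baseChange E).toAffine.Point →+ _).range).comap
          (Affine.Point.baseChange (W' := W) K E)) *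
      (T ⊔ (zsmulAddGroupHom n : (W.baseChange E).toAffine.Point →+ _).range).index =
    ((zsmulAddGroupHom n : W.toAffine.Point →+ _).range).index *
      ((Affine.Point.baseChange (W' := W) K E).range ⊔
        (T ⊔ (zsmulAddGroupHom n : (W.baseChange E).toAffine.Point →+ _).range)).index := by
  set ι := Affine.Point.baseChange (W' := W) K E with hι
  set NK := (zsmulAddGroupHom n : W.toAffine.Point →+ _).range with hNK
  set NE := T ⊔ (zsmulAddGroupHom n : (W.baseChange E).toAffine.Point →+ _).range with hNE
  have hle : NK ≤ NE.comap ι := by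
    rintro _ ⟨P, rfl⟩
    exact AddSubgroup.mem_sup_right ⟨ι P, (map_zsmul ι n P).symm⟩
  have h1 : NK.relIndex (NE.comap ι) * (NE.comap ι).index = NK.index := AddSubgroup.relIndex_mul_index hle
  have h2 : (NE.comap ι).index = NE.relIndex ι.range := AddSubgroup.index_comap NE ι
  have h3 : NE.relIndex (ι.range ⊔ NE) * (ι.range ⊔ NE).index = NE.index :=
    AddSubgroup.relIndex_mul_index le_sup_right
  have h4 : NE.relIndex (ι.range ⊔ NE) = NE.relIndex ι.range := AddSubgroup.relIndex_sup_right _ _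
  calc NK.relIndex (NE.comap ι) * NE.index
      = NK.relIndex (NE.comap ι) * (NE.relIndex ι.range * (ι.range ⊔ NE).index) := by rw [← h3, h4]
    _ = NK.relIndex (NE.comap ι) * (NE.comap ι).index * (ι.range ⊔ NE).index := by rw [h2]; ring
    _ = NK.index * (ι.range ⊔ NE).index := by rw [h1]

include hn in
/-- **PART A WITH a torsion-valued local condition, assembled.** For `E` a `K`-field of
characteristic `0` (a completion `K_v`) and ANY subgroup `T ≤ (W⁄E)(E)` (the torsion of `E(K_𝔭)`):
`#(Sel⁽ⁿ⁾(E/K) ∩ res_E⁻¹(κ_{n,E}(T))) · [(W⁄E)(E) : T + n(W⁄E)(E)] ≤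
  #Ш(E/K)[n] · [E(K) : nE(K)] · [(W⁄E)(E) : (T + n(W⁄E)(E)) + im E(K)]`
— Steps 1–2 of Jetchev–Skinner–Wan 2017 Prop. 3.2.1 (`≤`) with the `#H⁰(K_𝔭, E[p^∞])`-factor kept
(no (iv)). [cite: JetchevSkinnerWan2017, Prop. 3.2.1 (proof, arXiv:1512.06894 pp. 10–11)]
[cite: Castella2018, proof of Thm. 2.3, (3.2.1) and (calcul) (arXiv:1704.06608 pp. 5–6)] -/
theorem natCard_selmerGroup_inf_comap_mul_index_le
    (hdiv : ∀ P : geomPoints W, ∃ Q : geomPoints W, n • Q = P)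
    (T : AddSubgroup (W.baseChange E).toAffine.Point) :
    Nat.card ↥(selmerGroup W n ⊓
        (T.map (W.localKummerMap E hn)).comap (galoisCohomology.res (W.torsionGaloisModule n) E 1)) *
        (T ⊔ (zsmulAddGroupHom n : (W.baseChange E).toAffine.Point →+ _).range).index ≤
      Nat.card ↥(W.sha ⊓ AddSubgroup.torsionBy W.galH1 n) *
        (((zsmulAddGroupHom n : W.toAffine.Point →+ _).range).index *
          ((Affine.Point.baseChange (W' := W) K E).range ⊔
            (T ⊔ (zsmulAddGroupHom n : (W.baseChange E).toAffine.Point →+ _).range)).index) := by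
  rw [← relIndex_comap_mul_index_sup W E T, ← natCard_range_kummerMapTorsion_inf_comap W E hn hdiv T,
    ← mul_assoc]
  exact Nat.mul_le_mul_right _ (natCard_selmerGroup_inf_le_of W hn hdiv _)

end Summit.BirchSwinnertonDyer.Rank1Residual.X11b.StrictAtPlace

end
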